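import Summits.BirchSwinnertonDyer.BirchSwinnertonDyer.Theorems.ManinLocalTwoThreeShimuraIndexKatz
import Summits.BirchSwinnertonDyer.BirchSwinnertonDyer.Theorems.ManinLocalTwoThreeKatoCurveNoPlusDefectStub
import Summits.BirchSwinnertonDyer.Rank1Residual.ManinAdditive.TowerUnitTwist
import HarnessLib

/-!
# C2's no-rational-`2`-torsion / no-plus-defect cell modulo ONE cell law (E-an-135₂) — TURNKEY-an-15 ∘ an-16 with E-an-128₂ discharged;
# and the C3 twin on the class-`3`-torsion-free locus modulo E-an-135₃

Summit `BirchSwinnertonDyer`, route `ManinLocalTwoThree` (cell bsd-f2-manin), cruxes C2 `ManinOddAtFour`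
(stmt-BirchSwinnertonDyer-22967) and C3 `ManinPrimeToThreeAtNine` (stmt-BirchSwinnertonDyer-22968).  Prover seat
bsd-line-manin23-p1 (C2/C3 LEAD), gen 9.  Pure composition of tree theorems:

* `not_two_dvd_maninConstant_of_noRationalTwoTorsion_of_towerUnitTwist` — for a lattice-optimal globally minimal `W` with `4 ∣ N`,
  NO cuspidal plus defect at `2` and NO rational `2`-torsion: `2 ∤ c`, CONDITIONAL on the named hypotheses
  `exists_isNewformOf` (modularity), `kato_isIntegral_twistedSymbolSum_two_symbolClosure` (Kato, statement-only Literature fact),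
  `KatoCurveExists` (cell support law S-es-K) and the SINGLE cell law E-an-135₂ `TowerUnitTwist 2` — the es law E-es-66₂ being supplied
  by an's THEOREM E-an-136₂ `twoAdicWitness_of_towerUnitTwist` (typer-landed `…/ManinAdditive/TowerUnitTwist.lean`) and an's E-an-128₂
  by the lead's THEOREM `shimuraTwoForcesRationalTwoTorsion_holds` (inside `not_two_dvd_maninConstant_of_noRationalTwoTorsion'`).
* `not_three_dvd_maninConstant_of_forall_isogeny_addOrderOf_ne_of_towerUnitTwist` — C3 twin: lattice-optimal `W`, `9 ∣ N`, no cuspidal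
  plus defect at `3`, and no rational point of order `3` on `W` nor on any curve reached by a `ℚ`-isogeny of degree dividing `3`
  (so `PlusIndexPrimeTo 3` by the lead's Katz theorem `plusIndexPrimeTo_three_of_forall_isogeny_addOrderOf_ne`): `3 ∤ c`, CONDITIONAL on
  `exists_isNewformOf`, `kato_isIntegral_twistedSymbolSum_three_symbolClosure`, `KatoCurveExists` and E-an-135₃ `TowerUnitTwist 3`
  (E-es-66 by an's THEOREM `threeAdicWitness_of_towerUnitTwist`); E-es-67 is NOT needed on this locus.

HONEST FRAMING: by-name compositions; every hypothesis named above remains OPEN (two Kato facts are printed theorems, statement-only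
in the tree; `KatoCurveExists`, `TowerUnitTwist p` are cell laws).  C2, C3, Manin's conjecture and BSD are NOT proved by this file.
No definitions, no sorry.
-/

set_option autoImplicit false
set_option linter.dupNamespace false

noncomputable section

open scoped Classical MatrixGroups ModularForm

open CongruenceSubgroup Complex WeierstrassCurve Literature.NumberTheory.EllipticCurves
  Literature.NumberTheory.EllipticCurves.ModularForms
open Summit.BirchSwinnertonDyer.Rank1Residual.ManinAdditive.KatoCurve
  Summit.BirchSwinnertonDyer.Rank1Residual.ManinAdditive.CuspidalKummer
  Summit.BirchSwinnertonDyer.Rank1Residual.ManinAdditive.CuspidalKummerThree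

namespace Summit.BirchSwinnertonDyer.BirchSwinnertonDyer.Theorems.ManinLocalTwoThree

variable (W : WeierstrassCurve ℚ) [W.IsElliptic] [W.IsGloballyMinimal] {N : ℕ} [NeZero N]

/-- **C2 on the no-rational-`2`-torsion / no-plus-defect cell, modulo E-an-135₂ as the ONLY cell law** (plus modularity, Kato's
`p = 2` symbol-closure fact and `KatoCurveExists`): `2 ∤ c` for a lattice-optimal `W`, `4 ∣ N`, `CuspidalPlusDefectPrimeTo 2 D`, no
rational root of the `2`-division cubic.  (TURNKEY-an-15 `not_two_dvd_maninConstant_of_noRationalTwoTorsion'` ∘ E-an-136₂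
`twoAdicWitness_of_towerUnitTwist`.) [cite: Kato2004Asterisque, Thm. 12.5 (shape; the named fact is statement-only)] -/
theorem not_two_dvd_maninConstant_of_noRationalTwoTorsion_of_towerUnitTwist
    (hnf : exists_isNewformOf) (hF : kato_isIntegral_twistedSymbolSum_two_symbolClosure) (hK : KatoCurveExists)
    (h135 : TowerUnitTwist 2)
    (D : ModularParametrizationData W N) (hopt : ∀ z ∈ D.L.lattice, ∃ w ∈ periodLattice D.f, z = D.c * w)
    (h4 : 2 ^ 2 ∣ N) (hpd : CuspidalPlusDefectPrimeTo 2 D)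
    (hT : ∀ e : ℚ, ¬ W.twoTorsionPolynomial.toPoly.IsRoot e) : ¬ (2 : ℤ) ∣ D.c :=
  not_two_dvd_maninConstant_of_noRationalTwoTorsion' W hnf hF hK (twoAdicWitness_of_towerUnitTwist h135) D hopt h4 hpd hT

/-- **C3 twin on the class-`3`-torsion-free / no-plus-defect cell, modulo E-an-135₃ as the ONLY cell law** (plus modularity,
Kato's `p = 3` symbol-closure fact and `KatoCurveExists`): `3 ∤ c` for a lattice-optimal `W`, `9 ∣ N`, `CuspidalPlusDefectPrimeTo 3 D`,
and no rational point of order `3` on `W` or on any curve `ℚ`-isogenous to `W` by an isogeny of degree dividing `3`.  The plus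
index is prime to `3` there by the lead's Katz theorem, the polar witness comes from E-an-136₃ `threeAdicWitness_of_towerUnitTwist`,
and the lever is the tree's `not_three_dvd_maninConstant_of_noPlusDefect_stub` road with E-es-61's hypothesis met pointwise
(`threeAdicUnitWitnessOfNoRationalThreeTorsion_of_plusIndex` is global, so the pointwise form is assembled here directly from
`TwoAdic/ThreeAdicPolarWitness` consumers). [cite: Kato2004Asterisque, Thm. 12.5 (shape; the named fact is statement-only)] -/
theorem threeAdicPolarWitness_of_forall_isogeny_addOrderOf_ne_of_towerUnitTwist (h135 : TowerUnitTwist 3)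
    (D : ModularParametrizationData W N) (hopt : ∀ z ∈ D.L.lattice, ∃ w ∈ periodLattice D.f, z = D.c * w)
    (h9 : 3 ^ 2 ∣ N)
    (h : ∀ (W' : WeierstrassCurve ℚ) [W'.IsElliptic] (g : Isogeny W W'), g.degree ∣ 3 →
      ∀ Q : W'.toAffine.Point, addOrderOf Q ≠ 3) :
    ThreeAdicPolarWitness W W D.f :=
  threeAdicPolarWitness_of_forall_isogeny_addOrderOf_ne W (threeAdicWitness_of_towerUnitTwist h135) D hopt h9 h

/-- **The `p = 3` no-plus-defect lever with a POINTWISE polar witness** (the tree's `KatoCurve.not_three_dvd_maninConstant_of_noPlusDefect`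
with its global law E-es-61 replaced by a witness `ThreeAdicPolarWitness W W D.f` for the one datum at hand; E-es-63 discharged by
`katoCurvePeriodDvdOfNoPlusDefect_holds`; the `VK` side conditions as explicit hypotheses, as there): `3 ∤ c`.
[cite: Kato2004Asterisque, Thm. 12.5 (shape; the named fact is statement-only)] -/
theorem not_three_dvd_maninConstant_of_noPlusDefect_of_witness
    (hF : kato_isIntegral_twistedSymbolSum_three_symbolClosure)
    (D : ModularParametrizationData W N) (hopt : ∀ z ∈ D.L.lattice, ∃ w ∈ periodLattice D.f, z = D.c * w)
    (hpd : CuspidalPlusDefectPrimeTo 3 D) (hwitW : ThreeAdicPolarWitness W W D.f)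
    (VK : WeierstrassCurve ℚ) [VK.IsElliptic] [VK.IsGloballyMinimal]
    (hiso : IsIsogenous W VK) (hK : IsSymbolClosureCurve VK D.f)
    (hnewK : IsNewformOf VK D.f) (hgK : ¬ VK.HasGoodReductionAtPrime 3)
    (hmK : ¬ VK.HasMultiplicativeReductionAtPrime 3) (haK : ∀ ℓ : ℕ, VK.LFunction ℓ = W.LFunction ℓ) :
    ¬ (3 : ℤ) ∣ D.c := by
  have hwit : ThreeAdicPolarWitness W VK D.f :=
    threeAdicPolarWitness_of_periodDividesAt W VK W D.f hwitW
      (katoCurvePeriodDvdOfNoPlusDefect_holds 3 W D hopt hpd VK hiso hK) hnewK hgK hmK haK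
  have hFact : KatoFactThreeAt VK D.f := hF VK D.f hK
  have hΩ : W.realPeriodRat = ((|D.c| : ℤ) : ℝ) * plusPeriod D.f := by
    rw [Int.cast_abs]; exact D.realPeriodRat_eq_abs_mul_plusPeriod_of_latticeEq hopt
  have hc0 : D.c ≠ 0 := D.maninConstant_ne_zero_holds
  have h := not_three_dvd_of_katoFactThreeAt_of_witness W VK D.f |D.c| hFact hwit hΩ (abs_ne_zero.mpr hc0)
  exact fun h3 => h ((dvd_abs 3 D.c).mpr h3)

/-- The same with the `VK` side conditions discharged by modularity `exists_isNewformOf` (additivity at `3` from `9 ∣ N`,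
`not_good_and_not_mult_of_sq_dvd_level`) and the support law `KatoCurveExists` — the pointwise-witness form of the tree's
`not_three_dvd_maninConstant_of_noPlusDefect_stub` (no E-es-61).
[cite: Kato2004Asterisque, Thm. 12.5 (shape; the named fact is statement-only)] -/
theorem not_three_dvd_maninConstant_of_noPlusDefect_of_witness_stub
    (hnf : exists_isNewformOf) (hF : kato_isIntegral_twistedSymbolSum_three_symbolClosure) (hK : KatoCurveExists)
    (D : ModularParametrizationData W N) (hopt : ∀ z ∈ D.L.lattice, ∃ w ∈ periodLattice D.f, z = D.c * w)
    (h9 : 3 ^ 2 ∣ N) (hpd : CuspidalPlusDefectPrimeTo 3 D) (hwitW : ThreeAdicPolarWitness W W D.f) :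
    ¬ (3 : ℤ) ∣ D.c := by
  obtain ⟨VK, _, _, hiso, hKC⟩ := hK W D hopt
  have hiso' : IsIsogenous VK W := hiso.symm_of_isElliptic
  have hnewK : IsNewformOf VK D.f := IsNewformOf.of_isIsogenous D.isNewformOf hiso'
  haveI : Fact (Nat.Prime 3) := ⟨Nat.prime_three⟩
  have hadd := not_good_and_not_mult_of_sq_dvd_level hnf hnewK h9
  have haK : ∀ ℓ : ℕ, VK.LFunction ℓ = W.LFunction ℓ := fun ℓ => by rw [hiso.LFunction_eq]
  exact not_three_dvd_maninConstant_of_noPlusDefect_of_witness W hF D hopt hpd hwitW VK hiso hKC hnewK hadd.1 hadd.2 haK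

/-- **C3 on the class-`3`-torsion-free / no-plus-defect cell, modulo E-an-135₃ as the ONLY cell law besides `KatoCurveExists`**
(plus modularity and Kato's `p = 3` symbol-closure fact): `3 ∤ c` for a lattice-optimal `W`, `9 ∣ N`, `CuspidalPlusDefectPrimeTo 3 D`,
and no rational point of order `3` on `W` or on any curve reached from `W` by a `ℚ`-isogeny of degree dividing `3`.  (Katz for
the plus index, E-an-136₃ `threeAdicWitness_of_towerUnitTwist` for the witness, the pointwise lever above; E-es-67 NOT needed.)
[cite: Kato2004Asterisque, Thm. 12.5 (shape; the named fact is statement-only)] [cite: Katz1980, Thm. 2 (m = ℓ)] -/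
theorem not_three_dvd_maninConstant_of_forall_isogeny_addOrderOf_ne_of_towerUnitTwist
    (hnf : exists_isNewformOf) (hF : kato_isIntegral_twistedSymbolSum_three_symbolClosure) (hK : KatoCurveExists)
    (h135 : TowerUnitTwist 3)
    (D : ModularParametrizationData W N) (hopt : ∀ z ∈ D.L.lattice, ∃ w ∈ periodLattice D.f, z = D.c * w)
    (h9 : 3 ^ 2 ∣ N) (hpd : CuspidalPlusDefectPrimeTo 3 D)
    (h : ∀ (W' : WeierstrassCurve ℚ) [W'.IsElliptic] (g : Isogeny W W'), g.degree ∣ 3 →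
      ∀ Q : W'.toAffine.Point, addOrderOf Q ≠ 3) : ¬ (3 : ℤ) ∣ D.c :=
  not_three_dvd_maninConstant_of_noPlusDefect_of_witness_stub W hnf hF hK D hopt h9 hpd
    (threeAdicPolarWitness_of_forall_isogeny_addOrderOf_ne_of_towerUnitTwist W h135 D hopt h9 h)

/-- Likewise on the `W[3]`-IRREDUCIBLE / no-plus-defect cell (`Ψ₃` without a rational root): `3 ∤ c` modulo modularity, Kato's
`p = 3` symbol-closure fact, `KatoCurveExists` and E-an-135₃ — an es-road closing of a cell that the line of record closes via the
Kato shift lever instead. [cite: Kato2004Asterisque, Thm. 12.5 (shape; the named fact is statement-only)] -/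
theorem not_three_dvd_maninConstant_of_forall_not_isRoot_Ψ₃_of_towerUnitTwist
    (hnf : exists_isNewformOf) (hF : kato_isIntegral_twistedSymbolSum_three_symbolClosure) (hK : KatoCurveExists)
    (h135 : TowerUnitTwist 3)
    (D : ModularParametrizationData W N) (hopt : ∀ z ∈ D.L.lattice, ∃ w ∈ periodLattice D.f, z = D.c * w)
    (h9 : 3 ^ 2 ∣ N) (hpd : CuspidalPlusDefectPrimeTo 3 D) (hΨ : ∀ x₀ : ℚ, ¬ W.Ψ₃.IsRoot x₀) : ¬ (3 : ℤ) ∣ D.c :=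
  not_three_dvd_maninConstant_of_noPlusDefect_of_witness_stub W hnf hF hK D hopt h9 hpd
    (threeAdicPolarWitness_of_forall_not_isRoot_Ψ₃ W (threeAdicWitness_of_towerUnitTwist h135) D hopt h9 hΨ)

end Summit.BirchSwinnertonDyer.BirchSwinnertonDyer.Theorems.ManinLocalTwoThree

end
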